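import Summits.Ventures.PercRepro.RLSLossyTailT2
import Summits.Ventures.PercRepro.RLSLossyTailT1
import Summits.Ventures.PercRepro.RLSTailT3
import Summits.Ventures.PercRepro.RLSTailT2
import Summits.Ventures.PercRepro.RLSTailT1
import Summits.Ventures.PercRepro.RLSSmallP

/-!
# C-025 at q = 3: the tail lemma ASSEMBLED — count ⇒ per-plane inequality, generic and dependent-witness worlds (night-3 g2)

The tail lemma (proofs/N3-R3PLUS-plan.md §2.6, proofs/N3-TAIL-LOSSY.md §3) for a simple plane `G` with `≥ 10` points that is not a
near-pencil: with `n₃, n₄, n₅` the rank-3 subsets of `3, 4, 5` points (`ρ₃ ≥ 1, 3, 8`), `np` the near-pencil-shaped subsets and `w` the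
winners, the pure-form `R₃⁺` supply is at least `n₃·T_t(0) + 3n₄·T_t(1) + 8n₅·T_t(2) + np·tie_t + w·W_t` in the generic world and at least the
same with the losses of N3-TAIL-LOSSY.md §2 subtracted in the dependent-witness worlds, while the demand is at most
`Φ(p,3)·(n₃ + n₄ + n₅ + np + w)`.  The five theorems below are the linear-arithmetic step «the rate inequalities + the count
`w ≥ n₃/3 + 0.27·n₄ + 0.17·n₅ (+ 0.014·np)` ⇒ demand ≤ supply», for every `p = n + 4 ≥ 8` and every tuple of counts: they turn the
per-type rate theorems (`RLSTailT{3,2,1}` + `RLSSmallP` generic, `RLSLossyTailT{2,1}` lossy) into ONE inequality per world that a count of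
the plane feeds directly.  No `decide`, no tables.
-/

open PercRepro.NightThree PercRepro.NightThree.CF

namespace PercRepro.NightThree.TailAssembly

open Finset

/-- `T_t(0) ≤ Φ(p,3)` termwise: `C(p−t, x) ≤ C(p, x)`. -/
theorem t0_le_phi (n a : ℕ) (ha : a ≤ 4) :
    (∑ i ∈ range n, ((n + a).choose (i + 1) : ℚ) / ((i + 4).choose 3 : ℚ)) ≤
      ∑ i ∈ range n, ((n + 4).choose (i + 1) : ℚ) / ((i + 4).choose 3 : ℚ) := by
  apply sum_le_sum
  intro i _
  gcongr

/-- **Generic world, `t = 3`, assembled** (every `p = n + 4 ≥ 8`): the count `n₃/3 + 0.27·n₄ + 0.17·n₅ + 0.014·np ≤ w` gives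
`Φ·(n₃ + n₄ + n₅ + np + w) ≤ n₃·u0 + 3·n₄·u1 + 8·n₅·u2 + np·utie + w·w3`. -/
theorem tail_generic_t3 (n : ℕ) (hn : 4 ≤ n) (n3 n4 n5 np w : ℕ)
    (hcount : (n3 : ℚ) / 3 + 27 / 100 * n4 + 17 / 100 * n5 + 14 / 1000 * np ≤ w) :
    (∑ i ∈ range n, ((n + 4).choose (i + 1) : ℚ) / ((i + 4).choose 3 : ℚ)) * (n3 + n4 + n5 + np + w) ≤
      n3 * U3.u0Sum n + 3 * n4 * U3.u1Sum n + 8 * n5 * U3.u2Sum n + np * U3.utieSum n + w * U3.w3Sum n := by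
  have h1 : (∑ i ∈ range n, ((n + 4).choose (i + 1) : ℚ) / ((i + 4).choose 3 : ℚ)) * 4 ≤ 3 * U3.u0Sum n + 1 * U3.w3Sum n := by
    rcases Nat.lt_or_ge n 5 with h | h
    · interval_cases n; exact SmallP.tail_triple_t3_n4
    · exact U3.Tail.tail_triple_t3 n h
  have h2 : (∑ i ∈ range n, ((n + 4).choose (i + 1) : ℚ) / ((i + 4).choose 3 : ℚ)) * 127 ≤ 300 * U3.u1Sum n + 27 * U3.w3Sum n := by
    rcases Nat.lt_or_ge n 5 with h | h
    · interval_cases n; exact SmallP.tail_four_t3_n4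
    · exact U3.Tail.tail_four_t3 n h
  have h3 : (∑ i ∈ range n, ((n + 4).choose (i + 1) : ℚ) / ((i + 4).choose 3 : ℚ)) * 117 ≤ 800 * U3.u2Sum n + 17 * U3.w3Sum n := by
    rcases Nat.lt_or_ge n 5 with h | h
    · interval_cases n; exact SmallP.tail_five_t3_n4
    · exact U3.Tail.tail_five_t3 n h
  have h4 : (∑ i ∈ range n, ((n + 4).choose (i + 1) : ℚ) / ((i + 4).choose 3 : ℚ)) * 507 ≤ 7 * U3.w3Sum n + 500 * U3.utieSum n := by
    rcases Nat.lt_or_ge n 5 with h | h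
    · interval_cases n; exact SmallP.tail_np_t3_n4
    · exact U3.Tail.tail_np_t3 n h
  have h0 : U3.u0Sum n ≤ ∑ i ∈ range n, ((n + 4).choose (i + 1) : ℚ) / ((i + 4).choose 3 : ℚ) := t0_le_phi n 1 (by norm_num)
  set Φ := ∑ i ∈ range n, ((n + 4).choose (i + 1) : ℚ) / ((i + 4).choose 3 : ℚ) with hΦ
  have hD : 0 ≤ U3.w3Sum n - Φ := by linarith
  have hc := mul_le_mul_of_nonneg_right hcount hD
  have hn3 : (0 : ℚ) ≤ n3 := by positivity
  have hn4 : (0 : ℚ) ≤ n4 := by positivity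
  have hn5 : (0 : ℚ) ≤ n5 := by positivity
  have hnp : (0 : ℚ) ≤ np := by positivity
  nlinarith [mul_le_mul_of_nonneg_left h1 hn3, mul_le_mul_of_nonneg_left h2 hn4, mul_le_mul_of_nonneg_left h3 hn5,
    mul_le_mul_of_nonneg_left h4 hnp]

/-- **Generic world, `t = 2`, assembled** (every `p = n + 4 ≥ 8`). -/
theorem tail_generic_t2 (n : ℕ) (hn : 4 ≤ n) (n3 n4 n5 np w : ℕ)
    (hcount : (n3 : ℚ) / 3 + 27 / 100 * n4 + 17 / 100 * n5 + 14 / 1000 * np ≤ w) :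
    (∑ i ∈ range n, ((n + 4).choose (i + 1) : ℚ) / ((i + 4).choose 3 : ℚ)) * (n3 + n4 + n5 + np + w) ≤
      n3 * U2.r0Sum n + 3 * n4 * U2.r1Sum n + 8 * n5 * U2.r2Sum n + np * U2.rtieSum n + w * U2.w2Sum n := by
  have h1 := U2.Tail.tail_triple_t2 n hn
  have h2 := U2.Tail.tail_four_t2 n hn
  have h3 := U2.Tail.tail_five_t2 n hn
  have h4 := U2.Tail.tail_np_t2 n hn
  have h0 : U2.r0Sum n ≤ ∑ i ∈ range n, ((n + 4).choose (i + 1) : ℚ) / ((i + 4).choose 3 : ℚ) := t0_le_phi n 2 (by norm_num)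
  set Φ := ∑ i ∈ range n, ((n + 4).choose (i + 1) : ℚ) / ((i + 4).choose 3 : ℚ) with hΦ
  have hD : 0 ≤ U2.w2Sum n - Φ := by linarith
  have hc := mul_le_mul_of_nonneg_right hcount hD
  have hn3 : (0 : ℚ) ≤ n3 := by positivity
  have hn4 : (0 : ℚ) ≤ n4 := by positivity
  have hn5 : (0 : ℚ) ≤ n5 := by positivity
  have hnp : (0 : ℚ) ≤ np := by positivity
  nlinarith [mul_le_mul_of_nonneg_left h1 hn3, mul_le_mul_of_nonneg_left h2 hn4, mul_le_mul_of_nonneg_left h3 hn5,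
    mul_le_mul_of_nonneg_left h4 hnp]

/-- **Generic world, `t = 1`, assembled** (every `p = n + 4 ≥ 8`). -/
theorem tail_generic_t1 (n : ℕ) (hn : 4 ≤ n) (n3 n4 n5 np w : ℕ)
    (hcount : (n3 : ℚ) / 3 + 27 / 100 * n4 + 17 / 100 * n5 + 14 / 1000 * np ≤ w) :
    (∑ i ∈ range n, ((n + 4).choose (i + 1) : ℚ) / ((i + 4).choose 3 : ℚ)) * (n3 + n4 + n5 + np + w) ≤
      n3 * U1.q0Sum n + 3 * n4 * U1.q1Sum n + 8 * n5 * U1.q2Sum n + np * U1.qtieSum n + w * U1.w1Sum n := by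
  have h1 := U1.Tail.tail_triple_t1 n hn
  have h2 := U1.Tail.tail_four_t1 n hn
  have h3 := U1.Tail.tail_five_t1 n hn
  have h4 := U1.Tail.tail_np_t1 n hn
  have h0 : U1.q0Sum n ≤ ∑ i ∈ range n, ((n + 4).choose (i + 1) : ℚ) / ((i + 4).choose 3 : ℚ) := t0_le_phi n 3 (by norm_num)
  set Φ := ∑ i ∈ range n, ((n + 4).choose (i + 1) : ℚ) / ((i + 4).choose 3 : ℚ) with hΦ
  have hD : 0 ≤ U1.w1Sum n - Φ := by linarith
  have hc := mul_le_mul_of_nonneg_right hcount hD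
  have hn3 : (0 : ℚ) ≤ n3 := by positivity
  have hn4 : (0 : ℚ) ≤ n4 := by positivity
  have hn5 : (0 : ℚ) ≤ n5 := by positivity
  have hnp : (0 : ℚ) ≤ np := by positivity
  nlinarith [mul_le_mul_of_nonneg_left h1 hn3, mul_le_mul_of_nonneg_left h2 hn4, mul_le_mul_of_nonneg_left h3 hn5,
    mul_le_mul_of_nonneg_left h4 hnp]

/-- **Dependent-witness world, `t = 2` (one `N`-parallel pair), assembled** (every `p = n + 4 ≥ 8`): with the losses
`pt_2` per near-pencil-shaped subset and `pw_2` per winner (N3-TAIL-LOSSY.md §2), the count `n₃/3 + 0.27·n₄ + 0.17·n₅ ≤ w` gives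
`Φ·(n₃ + n₄ + n₅ + np + w) ≤ n₃·r0 + 3·n₄·r1 + 8·n₅·r2 + np·(rtie − pt) + w·(w2 − pw)`. -/
theorem tail_lossy_t2 (n : ℕ) (hn : 4 ≤ n) (n3 n4 n5 np w : ℕ)
    (hcount : (n3 : ℚ) / 3 + 27 / 100 * n4 + 17 / 100 * n5 ≤ w) :
    (∑ i ∈ range n, ((n + 4).choose (i + 1) : ℚ) / ((i + 4).choose 3 : ℚ)) * (n3 + n4 + n5 + np + w) ≤
      n3 * U2.r0Sum n + 3 * n4 * U2.r1Sum n + 8 * n5 * U2.r2Sum n + np * (U2.rtieSum n - U2.ptSum n) +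
        w * (U2.w2Sum n - U2.pwSum n) := by
  have h1 := U2.LossyTail.ltail_triple_t2 n hn
  have h2 := U2.LossyTail.ltail_four_t2 n hn
  have h3 := U2.LossyTail.ltail_five_t2 n hn
  have h4 := U2.LossyTail.ltail_np_t2 n hn
  have h0 : U2.r0Sum n ≤ ∑ i ∈ range n, ((n + 4).choose (i + 1) : ℚ) / ((i + 4).choose 3 : ℚ) := t0_le_phi n 2 (by norm_num)
  set Φ := ∑ i ∈ range n, ((n + 4).choose (i + 1) : ℚ) / ((i + 4).choose 3 : ℚ) with hΦ
  have hD : 0 ≤ U2.w2Sum n - U2.pwSum n - Φ := by linarith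
  have hc := mul_le_mul_of_nonneg_right hcount hD
  have hn3 : (0 : ℚ) ≤ n3 := by positivity
  have hn4 : (0 : ℚ) ≤ n4 := by positivity
  have hn5 : (0 : ℚ) ≤ n5 := by positivity
  have hnp : (0 : ℚ) ≤ np := by positivity
  nlinarith [mul_le_mul_of_nonneg_left h1 hn3, mul_le_mul_of_nonneg_left h2 hn4, mul_le_mul_of_nonneg_left h3 hn5,
    mul_le_mul_of_nonneg_left h4 hnp]

/-- **Dependent-witness world, `t = 1` (nullity 2: a 3-class or at most two pairs), assembled** (every `p = n + 4 ≥ 8`): with the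
losses `3·pt_1` per near-pencil-shaped subset, `3·pw_1 + cw` per winner, and the class losses `3·ct4` / `9·ct5` charged to every 4- and 5-subset
(N3-TAIL-LOSSY.md §2), the count `n₃/3 + 0.27·n₄ + 0.17·n₅ ≤ w` gives
`Φ·(n₃ + n₄ + n₅ + np + w) ≤ n₃·q0 + n₄·(3·q1 − 3·ct4) + n₅·(8·q2 − 9·ct5) + np·(qtie − 3·pt) + w·(w1 − cw − 3·pw)`. -/
theorem tail_lossy_t1 (n : ℕ) (hn : 4 ≤ n) (n3 n4 n5 np w : ℕ)
    (hcount : (n3 : ℚ) / 3 + 27 / 100 * n4 + 17 / 100 * n5 ≤ w) :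
    (∑ i ∈ range n, ((n + 4).choose (i + 1) : ℚ) / ((i + 4).choose 3 : ℚ)) * (n3 + n4 + n5 + np + w) ≤
      n3 * U1.q0Sum n + n4 * (3 * U1.q1Sum n - 3 * U1.ct4Sum n) + n5 * (8 * U1.q2Sum n - 9 * U1.ct5Sum n) +
        np * (U1.qtieSum n - 3 * U1.ptSum n) + w * (U1.w1Sum n - U1.cwSum n - 3 * U1.pwSum n) := by
  have h1 := U1.LossyTail.ltail_triple_t1 n hn
  have h2 := U1.LossyTail.ltail_four_t1 n hn
  have h3 := U1.LossyTail.ltail_five_t1 n hn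
  have h4 := U1.LossyTail.ltail_np_t1 n hn
  have h0 : U1.q0Sum n ≤ ∑ i ∈ range n, ((n + 4).choose (i + 1) : ℚ) / ((i + 4).choose 3 : ℚ) := t0_le_phi n 3 (by norm_num)
  set Φ := ∑ i ∈ range n, ((n + 4).choose (i + 1) : ℚ) / ((i + 4).choose 3 : ℚ) with hΦ
  have hD : 0 ≤ U1.w1Sum n - U1.cwSum n - 3 * U1.pwSum n - Φ := by linarith
  have hc := mul_le_mul_of_nonneg_right hcount hD
  have hn3 : (0 : ℚ) ≤ n3 := by positivity
  have hn4 : (0 : ℚ) ≤ n4 := by positivity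
  have hn5 : (0 : ℚ) ≤ n5 := by positivity
  have hnp : (0 : ℚ) ≤ np := by positivity
  nlinarith [mul_le_mul_of_nonneg_left h1 hn3, mul_le_mul_of_nonneg_left h2 hn4, mul_le_mul_of_nonneg_left h3 hn5,
    mul_le_mul_of_nonneg_left h4 hnp]

end PercRepro.NightThree.TailAssembly
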